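import Mathlib

/-!
# Separable Frobenius layer of a finitely generated field extension

Helper for the crux `stmt-ResolutionOfSingularities-10968` (route `Valuative`, decl
`TorsorToLurel`, line `Sketch`, perfect-closure descent): for a finitely generated extension
`K/k` of characteristic `p` there are a finite transcendence basis `x` of `K/k` and an exponent
`e` such that every `y ^ p ^ e` (`y ∈ K`) is separable over `k(x)`. Indeed `K` is finite over
`k(x)`, hence finite purely inseparable over the separable closure `k(x)_s` of `k(x)` in `K`, so
it has an exponent `e` with `K ^ {p ^ e} ⊆ k(x)_s`. The statement is transported into an
arbitrary further extension `Ω ⊇ K`, where it is consumed (Mac Lane's criterion).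
-/

noncomputable section

set_option linter.dupNamespace false

open IsLocalRing

namespace Summit.ResolutionOfSingularities.ResolutionOfSingularities.Theorems

/-- Separability of an element is transported along a pair of compatible ring homomorphisms
(`f` on the base fields, `g` on the top rings): the minimal polynomial of `g x` over `F₂`
divides the image under `f` of the (separable) minimal polynomial of `x` over `F₁`. -/
theorem ttl_isSeparable_of_ringHom_ringHom {F₁ F₂ A B : Type*} [Field F₁] [Field F₂] [Ring A]
    [Ring B] [Algebra F₁ A] [Algebra F₂ B] (f : F₁ →+* F₂) (g : A →+* B)
    (hfg : (algebraMap F₂ B).comp f = g.comp (algebraMap F₁ A)) {x : A} (h : IsSeparable F₁ x) :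
    IsSeparable F₂ (g x) := by
  have hdvd : minpoly F₂ (g x) ∣ (minpoly F₁ x).map f := by
    refine minpoly.dvd F₂ (g x) ?_
    rw [Polynomial.aeval_def, Polynomial.eval₂_map, hfg, ← Polynomial.hom_eval₂,
      ← Polynomial.aeval_def, minpoly.aeval, map_zero]
  exact Polynomial.Separable.of_dvd (Polynomial.Separable.map h) hdvd

/-- A finitely generated field extension `K/k` has a finite transcendence basis
`x : Fin n → K` (extracted from a finite generating set) over whose generated subfield `k(x)`
the field `K` is finite-dimensional (algebraic and finitely generated). -/
theorem ttl_exists_fin_isTranscendenceBasis (k K : Type) [Field k] [Field K] [Algebra k K]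
    (hfg : (⊤ : IntermediateField k K).FG) :
    ∃ (n : ℕ) (x : Fin n → K), IsTranscendenceBasis k x ∧
      FiniteDimensional (IntermediateField.adjoin k (Set.range x)) K := by
  classical
  obtain ⟨s, hs⟩ := hfg
  haveI halg : Algebra.IsAlgebraic (Algebra.adjoin k (s : Set K)) K := by
    rw [← IntermediateField.isAlgebraic_adjoin_iff_top, hs, Algebra.isAlgebraic_iff_isIntegral]
    exact Algebra.isIntegral_of_surjective IntermediateField.topEquiv.surjective
  obtain ⟨t, hts, ht⟩ := exists_isTranscendenceBasis_subset (R := k) (s : Set K)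
  haveI : Fintype t := (s.finite_toSet.subset hts).fintype
  have hxb : IsTranscendenceBasis k (((↑) : t → K) ∘ (Fintype.equivFin t).symm) :=
    ht.comp_equiv _
  refine ⟨Fintype.card t, ((↑) : t → K) ∘ (Fintype.equivFin t).symm, hxb, ?_⟩
  -- `K` is algebraic over `F := k(x)` and generated over it by the finite set `s`
  set F := IntermediateField.adjoin k (Set.range (((↑) : t → K) ∘ (Fintype.equivFin t).symm))
  haveI : Algebra.IsAlgebraic F K := hxb.isAlgebraic_field
  have htop : IntermediateField.adjoin F (s : Set K) = ⊤ := by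
    refine eq_top_iff.mpr fun z _ => ?_
    have hz : z ∈ IntermediateField.adjoin k (s : Set K) := by rw [hs]; trivial
    have hle : IntermediateField.adjoin k (s : Set K) ≤
        (IntermediateField.adjoin F (s : Set K)).restrictScalars k :=
      IntermediateField.adjoin_le_iff.mpr (IntermediateField.subset_adjoin F (s : Set K))
    exact hle hz
  haveI hfin : FiniteDimensional F (IntermediateField.adjoin F (s : Set K)) :=
    IntermediateField.finiteDimensional_adjoin fun z _ =>
      (Algebra.IsAlgebraic.isAlgebraic (R := F) z).isIntegral
  rw [htop] at hfin
  exact LinearEquiv.finiteDimensional (IntermediateField.topEquiv (F := F) (E := K)).toLinearEquiv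

/-- Over an intermediate field `E` of `K/k` (`char k = p`) with `[K : E] < ∞`, one fixed
Frobenius power `y ^ p ^ e` of every `y : K` is separable over `E`: take for `e` the exponent of
the finite purely inseparable layer `K / E_s`, `E_s` the separable closure of `E` in `K`. -/
theorem ttl_exists_exponent_isSeparable (p : ℕ) [Fact p.Prime] (k K : Type) [Field k]
    [CharP k p] [Field K] [Algebra k K] (E : IntermediateField k K) [FiniteDimensional E K] :
    ∃ e : ℕ, ∀ y : K, IsSeparable E (y ^ p ^ e) := by
  refine ⟨IsPurelyInseparable.exponent (separableClosure E K) K, fun y => ?_⟩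
  obtain ⟨z, hz⟩ := IsPurelyInseparable.exponent_def' (separableClosure E K) p y
  rw [← hz]
  exact mem_separableClosure_iff.mp z.2

/-- Transport into a further extension `Ω ⊇ K`: an element `y : K` separable over the subfield
`k(x) ⊆ K` has image in `Ω` separable over the subfield `k(x) ⊆ Ω` generated by the images of
the `x i` (the map `K → Ω` restricts to a ring homomorphism `k(x) → k(x)` compatible with the
structure maps). -/
theorem ttl_isSeparable_adjoin_algebraMap (k K Ω : Type) [Field k] [Field K] [Algebra k K]
    [Field Ω] [Algebra k Ω] [Algebra K Ω] [IsScalarTower k K Ω] {n : ℕ} (x : Fin n → K) {y : K}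
    (hy : IsSeparable (IntermediateField.adjoin k (Set.range x)) y) :
    IsSeparable (IntermediateField.adjoin k (Set.range fun i => algebraMap K Ω (x i)))
      (algebraMap K Ω y) := by
  have hle : IntermediateField.adjoin k (Set.range x) ≤
      (IntermediateField.adjoin k (Set.range fun i => algebraMap K Ω (x i))).comap
        (IsScalarTower.toAlgHom k K Ω) :=
    IntermediateField.adjoin_le_iff.mpr (by
      rintro _ ⟨i, rfl⟩
      show (IsScalarTower.toAlgHom k K Ω) (x i) ∈
        IntermediateField.adjoin k (Set.range fun i => algebraMap K Ω (x i))
      exact IntermediateField.subset_adjoin k _ ⟨i, rfl⟩)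
  have hmem : ∀ z : IntermediateField.adjoin k (Set.range x),
      ((algebraMap K Ω).comp (algebraMap (IntermediateField.adjoin k (Set.range x)) K)) z ∈
        IntermediateField.adjoin k (Set.range fun i => algebraMap K Ω (x i)) :=
    fun z => hle z.2
  exact ttl_isSeparable_of_ringHom_ringHom (RingHom.codRestrict _ _ hmem) (algebraMap K Ω)
    (RingHom.ext fun _ => rfl) hy

/-- **Separable Frobenius layer**: for a finitely generated extension `K/k` of characteristic
`p` there are a transcendence basis `x : Fin n → K` of `K/k` and an exponent `e` such that every
`y ^ p ^ e` (`y ∈ K`) is separable over `k(x)`; stated after an arbitrary further field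
extension `Ω ⊇ K` (where it is consumed): the images of the `x i` in `Ω` are algebraically
independent over `k` and every `y ^ p ^ e` is separable over the subfield of `Ω` they generate
over `k`. -/
theorem stub_ttlSepLayer (p : ℕ) [Fact p.Prime] (k K : Type) [Field k] [CharP k p] [Field K]
    [Algebra k K] (hfg : (⊤ : IntermediateField k K).FG)
    (Ω : Type) [Field Ω] [Algebra k Ω] [Algebra K Ω] [IsScalarTower k K Ω] :
    ∃ (n : ℕ) (x : Fin n → K) (e : ℕ), AlgebraicIndependent k (fun i => algebraMap K Ω (x i)) ∧
      ∀ y : K, IsSeparable (IntermediateField.adjoin k (Set.range fun i => algebraMap K Ω (x i)))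
        (algebraMap K Ω (y ^ p ^ e)) := by
  obtain ⟨n, x, hxb, hfin⟩ := ttl_exists_fin_isTranscendenceBasis k K hfg
  obtain ⟨e, he⟩ :=
    ttl_exists_exponent_isSeparable p k K (IntermediateField.adjoin k (Set.range x))
  have hind : AlgebraicIndependent k (fun i => algebraMap K Ω (x i)) :=
    hxb.1.map' (f := IsScalarTower.toAlgHom k K Ω) (RingHom.injective _)
  exact ⟨n, x, e, hind, fun y => ttl_isSeparable_adjoin_algebraMap k K Ω x (he y)⟩

end Summit.ResolutionOfSingularities.ResolutionOfSingularities.Theorems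

end
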